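import Summits.BirchSwinnertonDyer.Rank1Residual.X11b.ProcyclicDescentKernel
import Summits.BirchSwinnertonDyer.Rank1Residual.X11b.ProcyclicDescentRescaled
import Summits.BirchSwinnertonDyer.Rank1Residual.X11b.BDPRouteLocalKernelCoinvariants
import HarnessLib

/-!
# X11b, route R1 — Greenberg's `ker r_v ≅ H¹(Γ_v, B_v) = B_v/(γ_v − 1)B_v` as an EQUALITY of
# orders on the constructed objects at a place FINITELY DECOMPOSED in `K_∞` (Step 1b of atom (P11))

HONEST FRAMING (cell `b2b-bsdres`, run/shared/lean/b2b/bsd-rank1-residual/, verbatim in every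
file): the goal of the cell is to DELETE the COMBINATION-SHAPED residual classes of the
Birch–Swinnerton-Dyer formula for ALL analytic-rank `≤ 1` elliptic curves over `ℚ` — "full BSD
formula for every rank `≤ 1` curve in class `C`" assembled STRICTLY from published theorems — so
that the rank-`≤ 1` remainder becomes exactly the CONSTRUCTION-SHAPED classes, which are TYPED
(missing-input `Prop`s), NOT attempted. This is not "finishing BSD". Sub-cell
`b2b-bsdres-multr1-p1` (X11b, route R1 = Castella 2018 Thm. A re-proved along the author's
erratum); a RESEARCH ROUTE; no claim beyond the stated class; X11b stays CONSTRUCTION-SHAPED;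
nothing here changes a label; no named fact is minted (theorems only; no definition; no `sorry`).

## What this file proves

Route p2's `finite_localKer_and_natCard_le` (Greenberg LNM 1716, proof of Lemma 3.3, first half:
inflation–restriction) bounds the local kernel `ker r_v = ker (H¹(D_v, M) → H¹(D_v ⊓ ker κ, M))`
(`localKer (ker κ) M v`) by `#(B_v/(γ_v − 1)B_v)`, `B_v = M^{ker κ ⊓ D_v}`, for every `γ_v ∈ D_v`
generating `D_v` topologically modulo `D_v ⊓ ker κ`.  Gen 17's procyclic descent engine (c′)
(`ProcyclicDescent.natCard_ker_resSubgroup_eq`: for a profinite `G`, `κ : G ↠ ℤ_p`, `H = ker κ`,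
`κ(γ) = 1`, `A` discrete `p`-primary, `#ker(H¹(G,A) → H¹(H,A)) = #(A^H/(γ⁻¹ − 1)A^H)`) turns it into
an EQUALITY once transported to `G = D_v` with `κ|_{D_v}` rescaled onto `ℤ_p` — which requires
`κ|_{D_v} ≠ 1`, i.e. `v` FINITELY DECOMPOSED (not split completely) in `K_∞/K`:

* `isUnit_of_generate` — if `g` generates `D_v` modulo `D_v ⊓ ker κ` (p2's open-subgroup
  form) and `κ(D_v) = p^a ℤ_p ≠ 0`, then `κ(g) = p^a · (unit)` (otherwise the proper open layer
  subgroup `κ⁻¹(p^{a+1}ℤ_p) ∩ D_v` contains `ker κ ∩ D_v` and `g`);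
* **`natCard_localKer_eq_natCard_quotient_range_decompSubOne`** — for a `ℤ_p`-extension `κ`, a
  discrete `p`-primary `Γ_K`-module `M` with continuous orbit maps, a finite place `v` with
  `¬ D_v ≤ ker κ`, and ANY `g ∈ D_v` generating `D_v` topologically modulo `D_v ⊓ ker κ`:
  `#ker r_v = #(B_v/(g − 1)B_v)` (as `Nat.card`; both sides `0` if infinite). Greenberg: "`ker(r_v) ≅
  H¹(Γ_v, B_v)` … `H¹(Γ_v, B_v) = B_v/(γ_v − 1)B_v`" (p. 87) — here on the tree's objects, with no
  residual input.

What is NOT here: the order of `B_v/(γ_v − 1)B_v` (`= c_v^{(p)}`: Tate curve / component group,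
the rest of atom (P11)); the arithmetic input `¬ D_v ≤ ker κ` at split `v ∣ N⁺` (Brink 2007 for the
anticyclotomic tower; vendored separately as a cited fact).

References: [GreenbergLNM1716] §3, proof of Lemma 3.3 (p. 87); [SerreGaloisCohomology1997] I §2.6(b),
XIII §1; [Washington1997] §13.1; [JetchevSkinnerWan2017] Prop. 3.3.4 (arXiv:1512.06894 pp. 12–13).
-/

noncomputable section

open scoped Classical

open NumberField IsDedekindDomain Field Function
open Literature.NumberTheory.EllipticCurves Literature.NumberTheory.EllipticCurves.GreenbergSelmer
open Literature.NumberTheory.GaloisRepresentations Literature.NumberTheory.EllipticCurves.ResKernel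

universe u

namespace Summit.BirchSwinnertonDyer.Rank1Residual.X11b.AcSelmer

/-! ## 1. Twisting a character by a `p`-adic unit -/

section Twist

variable {G : Type u} [Group G] [TopologicalSpace G] {p : ℕ} [Fact p.Prime]
  (κ₀ : G →ₜ* Multiplicative ℤ_[p]) (w : ℤ_[p]ˣ)

/-- The unit twist `w • κ₀` of a continuous character `G → ℤ_p` (same kernel). [cite: Washington1997, §13.1] -/
theorem mulUnit_comp_apply (g : G) :
    (ZpExtension.mulUnit w).comp κ₀ g = Multiplicative.ofAdd ((w : ℤ_[p]) * (κ₀ g).toAdd) := rfl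

/-- `ker (w • κ₀) = ker κ₀`. [folklore] -/
theorem kerK_mulUnit_comp : ProcyclicDescent.kerK ((ZpExtension.mulUnit w).comp κ₀) =
    ProcyclicDescent.kerK κ₀ := by
  ext g
  rw [MonoidHom.mem_ker, MonoidHom.mem_ker]
  change (ZpExtension.mulUnit w).comp κ₀ g = 1 ↔ κ₀ g = 1
  rw [mulUnit_comp_apply]
  constructor
  · intro h
    have h' := congrArg Multiplicative.toAdd h
    rw [toAdd_ofAdd, toAdd_one, Units.mul_right_eq_zero] at h'
    exact Multiplicative.toAdd.injective (by rw [h', toAdd_one])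
  · intro h
    rw [h, toAdd_one, mul_zero]
    rfl

/-- `w • κ₀` is onto if `κ₀` is. [folklore] -/
theorem mulUnit_comp_surjective (h : Surjective κ₀) :
    Surjective ((ZpExtension.mulUnit w).comp κ₀) := by
  intro y
  obtain ⟨g, hg⟩ := h (Multiplicative.ofAdd ((↑w⁻¹ : ℤ_[p]) * y.toAdd))
  refine ⟨g, ?_⟩
  rw [mulUnit_comp_apply, hg, toAdd_ofAdd, ← mul_assoc, Units.mul_inv, one_mul, ofAdd_toAdd]

end Twist

/-! ## 2. The character `κ|_{D_v}` and a generator of `D_v` modulo `D_v ⊓ ker κ` -/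

section Decomp

variable {K : Type u} [Field K] [NumberField K] {p : ℕ} [Fact p.Prime] (κ : ZpExtension K p)

/-- `ker (κ|_{D_v}) = (ker κ) ⊓ D_v` viewed in `D_v` (`κ|_{D_v} = κ ∘ incl`). [folklore] -/
theorem kerK_comp_subgroupIncl (v : HeightOneSpectrum (𝓞 K)) :
    ProcyclicDescent.kerK (κ.toContinuousMonoidHom.comp
      (Literature.NumberTheory.GaloisRepresentations.subgroupIncl
        ((⊤ : Subgroup (absoluteGaloisGroup K)) ⊓ decomp v))) =
      κ.kerSubgroup.subgroupOf ((⊤ : Subgroup (absoluteGaloisGroup K)) ⊓ decomp v) := by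
  ext x
  rw [MonoidHom.mem_ker, Subgroup.mem_subgroupOf, ZpExtension.mem_kerSubgroup]
  rfl

/-- **If `g` generates `D_v` modulo `D_v ⊓ ker κ` and `κ(D_v) ∋ p^a` with `p^a ∣ κ(D_v)`, then
`κ(g) = p^a · c` with `c` a UNIT**: otherwise the open layer subgroup `κ⁻¹(p^{a+1}ℤ_p) ∩ D_v ⊋̸ D_v`
contains `ker κ ∩ D_v` and `g`, contradicting generation. [cite: Washington1997, §13.1]
[cite: GreenbergLNM1716, §3 Lemma 3.3 (proof, p. 87)] -/
theorem isUnit_of_generate {v : HeightOneSpectrum (𝓞 K)}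
    {g : ↥((⊤ : Subgroup (absoluteGaloisGroup K)) ⊓ decomp v)}
    (hgen : ∀ U : Subgroup ↥((⊤ : Subgroup (absoluteGaloisGroup K)) ⊓ decomp v),
      IsOpen (U : Set ↥((⊤ : Subgroup (absoluteGaloisGroup K)) ⊓ decomp v)) →
        κ.kerSubgroup.subgroupOf ((⊤ : Subgroup (absoluteGaloisGroup K)) ⊓ decomp v) ≤ U →
          g ∈ U → U = ⊤)
    {a : ℕ} {γ₀ : ↥((⊤ : Subgroup (absoluteGaloisGroup K)) ⊓ decomp v)}
    (hγ₀ : (κ (γ₀ : absoluteGaloisGroup K)).toAdd = (p : ℤ_[p]) ^ a) {c : ℤ_[p]}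
    (hc : (κ (g : absoluteGaloisGroup K)).toAdd = (p : ℤ_[p]) ^ a * c) : IsUnit c := by
  by_contra hcu
  -- `p ∣ c`
  have hpc : (p : ℤ_[p]) ∣ c := by
    have hlt : ‖c‖ < 1 := lt_of_le_of_ne c.2 (fun h ↦ hcu (PadicInt.isUnit_iff.mpr h))
    rwa [PadicInt.norm_lt_one_iff_dvd] at hlt
  obtain ⟨d, hd⟩ := hpc
  -- the layer subgroup `κ⁻¹(p^{a+1}ℤ_p) ∩ D_v`
  let D : Subgroup (absoluteGaloisGroup K) := (⊤ : Subgroup (absoluteGaloisGroup K)) ⊓ decomp v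
  let U : Subgroup D := (κ.layerSubgroup (a + 1)).subgroupOf D
  have hU : IsOpen (U : Set D) := (κ.isOpen_layerSubgroup (a + 1)).preimage continuous_subtype_val
  have hNU : κ.kerSubgroup.subgroupOf D ≤ U := fun x hx ↦
    Subgroup.mem_subgroupOf.mpr (κ.kerSubgroup_le_layerSubgroup (a + 1) (Subgroup.mem_subgroupOf.mp hx))
  have hgU : g ∈ U := by
    rw [Subgroup.mem_subgroupOf, ZpExtension.mem_layerSubgroup]
    refine ⟨d, ?_⟩
    rw [hc, hd, pow_succ, mul_assoc]
  have htop := hgen U hU hNU hgU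
  have hγ₀U : γ₀ ∈ U := by rw [htop]; exact Subgroup.mem_top _
  rw [Subgroup.mem_subgroupOf, ZpExtension.mem_layerSubgroup, hγ₀] at hγ₀U
  -- `p^{a+1} ∣ p^a` in `ℤ_p`: impossible
  obtain ⟨e, he⟩ := hγ₀U
  have hp : (p : ℤ_[p]) ≠ 0 := Nat.cast_ne_zero.mpr (Fact.out : p.Prime).ne_zero
  have h1 : (1 : ℤ_[p]) = p * e := by
    have := he
    rw [pow_succ, mul_assoc] at this
    exact mul_left_cancel₀ (pow_ne_zero a hp) (by rw [mul_one]; exact this)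
  have hunit : IsUnit (p : ℤ_[p]) := isUnit_iff_exists_inv.mpr ⟨e, h1.symm⟩
  have hnorm : ‖(p : ℤ_[p])‖ < 1 := PadicInt.norm_lt_one_iff_dvd _ |>.mpr (dvd_refl _)
  exact (ne_of_lt hnorm) (PadicInt.isUnit_iff.mp hunit)

end Decomp

/-! ## 3. `#ker r_v = #(B_v/(γ_v − 1)B_v)` at a place finitely decomposed in `K_∞` -/

section Exact

variable {K : Type u} [Field K] [NumberField K] {p : ℕ} [Fact p.Prime] (κ : ZpExtension K p)
variable (M : Type u) [AddCommGroup M] [DistribMulAction (absoluteGaloisGroup K) M]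
  [TopologicalSpace M] [DiscreteTopology M]

/-- **Greenberg's `ker(r_v) ≅ H¹(Γ_v, B_v) = B_v/(γ_v − 1)B_v` — EQUALITY OF ORDERS on the
constructed objects.**  For a `ℤ_p`-extension `κ` of a number field `K`, a discrete `p`-primary
`Γ_K`-module `M` with continuous orbit maps, a finite place `v` that does NOT split completely in
`K_∞/K` (`¬ D_v ≤ ker κ`, i.e. `Γ_v = D_v/(D_v ⊓ ker κ) ≃ ℤ_p`), and any `g ∈ D_v` generating `D_v`
topologically modulo `D_v ⊓ ker κ`: `#ker (H¹(D_v, M) → H¹(D_v ⊓ ker κ, M)) = #(B_v/(g − 1)B_v)`,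
`B_v = M^{ker κ ⊓ D_v}` (as `Nat.card`).  Proof: `κ|_{D_v}` has image `p^a ℤ_p ≠ 0`
(`imageIdeal_eq_bot_or`), `κ(g) = p^a·c` with `c` a unit (`isUnit_of_generate`); the rescaled and
twisted character `κ_v = (−c⁻¹ p^{−a}) κ|_{D_v} : D_v ↠ ℤ_p` has kernel `D_v ⊓ ker κ` and
`κ_v(g⁻¹) = 1`, so gen 17's engine `ProcyclicDescent.natCard_ker_resSubgroup_eq` applies with
`γ = g⁻¹` (`γ⁻¹ − 1 = g − 1`); the two kernels and the two coinvariant quotients are identified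
along `(ker κ).subgroupOf D_v ≅ ker κ ⊓ D_v`.  Route p2's `finite_localKer_and_natCard_le` is the
inequality `≤`. [cite: GreenbergLNM1716, §3 Lemma 3.3 (proof, p. 87)] [cite: SerreGaloisCohomology1997, I §2.6 (b) and XIII §1] -/
theorem natCard_localKer_eq_natCard_quotient_range_decompSubOne
    (hcont : ∀ m : M, Continuous fun σ : absoluteGaloisGroup K ↦ σ • m) (hM : IsPrimaryTorsion p M)
    {v : HeightOneSpectrum (𝓞 K)} (hv : ¬ decomp v ≤ κ.kerSubgroup)
    {g : ↥((⊤ : Subgroup (absoluteGaloisGroup K)) ⊓ decomp v)}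
    (hgen : ∀ U : Subgroup ↥((⊤ : Subgroup (absoluteGaloisGroup K)) ⊓ decomp v),
      IsOpen (U : Set ↥((⊤ : Subgroup (absoluteGaloisGroup K)) ⊓ decomp v)) →
        κ.kerSubgroup.subgroupOf ((⊤ : Subgroup (absoluteGaloisGroup K)) ⊓ decomp v) ≤ U →
          g ∈ U → U = ⊤) :
    Nat.card (localKer κ.kerSubgroup M v) =
      Nat.card (FixedPoints.addSubgroup ↥(κ.kerSubgroup ⊓ decomp v) M ⧸
        (decompSubOne κ M (g : absoluteGaloisGroup K) (Subgroup.mem_inf.mp g.2).2).range) := by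
  -- notation and instances on `D_v`
  let D : Subgroup (absoluteGaloisGroup K) := (⊤ : Subgroup (absoluteGaloisGroup K)) ⊓ decomp v
  let N : Subgroup D := κ.kerSubgroup.subgroupOf D
  have hgD : (g : absoluteGaloisGroup K) ∈ decomp v := (Subgroup.mem_inf.mp g.2).2
  have hA : ∀ m : M, IsOpen {x : D | x • m = m} := fun m ↦ by
    have h1 : IsOpen {σ : absoluteGaloisGroup K | σ • m = m} := by
      have : {σ : absoluteGaloisGroup K | σ • m = m} = (fun σ : absoluteGaloisGroup K ↦ σ • m) ⁻¹' {m} := by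
        ext σ; simp
      rw [this]
      exact (isOpen_discrete {m}).preimage (hcont m)
    exact h1.preimage continuous_subtype_val
  -- `κ|_{D_v}` is non-trivial with image `p^a ℤ_p`
  let lam : D →ₜ* Multiplicative ℤ_[p] := κ.toContinuousMonoidHom.comp
    (Literature.NumberTheory.GaloisRepresentations.subgroupIncl D)
  have hlam_apply : ∀ x : D, lam x = κ (x : absoluteGaloisGroup K) := fun _ ↦ rfl
  have hne : ¬ ∀ x : D, lam x = 1 := by
    intro h
    apply hv
    intro σ hσ
    have := h ⟨σ, Subgroup.mem_inf.mpr ⟨Subgroup.mem_top σ, hσ⟩⟩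
    rw [hlam_apply] at this
    exact ZpExtension.mem_kerSubgroup.mpr this
  obtain ⟨a, γ₀, hγ₀, hdiv⟩ := (ProcyclicDescent.imageIdeal_eq_bot_or lam).resolve_left hne
  obtain ⟨c, hc⟩ := hdiv g
  have hcu : IsUnit c := isUnit_of_generate κ hgen (γ₀ := γ₀) (by rw [← hlam_apply]; exact hγ₀)
    (by rw [← hlam_apply]; exact hc)
  -- the normalised character `κ_v` with `κ_v(g⁻¹) = 1`
  set w : ℤ_[p]ˣ := -hcu.unit⁻¹ with hw
  set κv : D →ₜ* Multiplicative ℤ_[p] :=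
    (ZpExtension.mulUnit w).comp (ProcyclicDescent.rescale lam a hdiv) with hκv
  have hsurj : Surjective κv :=
    mulUnit_comp_surjective _ w (ProcyclicDescent.rescale_surjective lam a hdiv γ₀ hγ₀)
  have hκvg : κv g = Multiplicative.ofAdd (-1) := by
    rw [hκv, mulUnit_comp_apply, ProcyclicDescent.rescale_eq_of_eq lam a hdiv g c hc, toAdd_ofAdd,
      hw]
    congr 1
    rw [Units.val_neg, neg_mul, Units.inv_mul_eq_one.mpr hcu.unit_spec.symm]
  have hone : κv g⁻¹ = Multiplicative.ofAdd 1 := by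
    rw [map_inv, hκvg, ← ofAdd_neg, neg_neg]
  have hker : ProcyclicDescent.kerK κv = N := by
    rw [hκv, kerK_mulUnit_comp, ProcyclicDescent.kerK_rescale, kerK_comp_subgroupIncl]
  -- the engine (c′)
  have hE := ProcyclicDescent.natCard_ker_resSubgroup_eq hA κv hsurj hone hM
  -- (i) the kernels: `localKer = ker (res : H¹(D, M) → H¹(N, M))`
  have hkerL : (ResKernel.resSubgroup (ProcyclicDescent.kerK κv) M).ker =
      (ResKernel.resSubgroup N M).ker := by rw [hker]
  let j : N →ₜ* ↥(κ.kerSubgroup ⊓ decomp v) :=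
    { toFun := fun x ↦ ⟨((x : D) : absoluteGaloisGroup K), Subgroup.mem_inf.mpr
        ⟨Subgroup.mem_subgroupOf.mp x.2, (Subgroup.mem_inf.mp (x : D).2).2⟩⟩
      map_one' := rfl
      map_mul' := fun _ _ ↦ rfl
      continuous_toFun := (continuous_subtype_val.comp continuous_subtype_val).subtype_mk _ }
  let j' : ↥(κ.kerSubgroup ⊓ decomp v) →ₜ* N :=
    { toFun := fun x ↦ ⟨⟨(x : absoluteGaloisGroup K), Subgroup.mem_inf.mpr
        ⟨Subgroup.mem_top _, (Subgroup.mem_inf.mp x.2).2⟩⟩,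
          Subgroup.mem_subgroupOf.mpr (Subgroup.mem_inf.mp x.2).1⟩
      map_one' := rfl
      map_mul' := fun _ _ ↦ rfl
      continuous_toFun := (continuous_subtype_val.subtype_mk _).subtype_mk _ }
  have hle : κ.kerSubgroup ⊓ decomp v ≤ D := inf_le_inf_right (decomp v) (le_top : κ.kerSubgroup ≤ ⊤)
  have hcomp : (resH1Hom j (AddMonoidHom.id M) (fun _ _ ↦ rfl)).comp (resOfLe M hle) =
      ResKernel.resSubgroup N M := by
    unfold Literature.NumberTheory.EllipticCurves.resOfLe ResKernel.resSubgroup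
    rw [resH1Hom_comp]
    exact resH1Hom_congr (ContinuousMonoidHom.ext fun _ ↦ rfl) (AddMonoidHom.ext fun _ ↦ rfl) _ _
  have hcomp' : (resH1Hom j' (AddMonoidHom.id M) (fun _ _ ↦ rfl)).comp (ResKernel.resSubgroup N M) =
      resOfLe M hle := by
    unfold Literature.NumberTheory.EllipticCurves.resOfLe ResKernel.resSubgroup
    rw [resH1Hom_comp]
    exact resH1Hom_congr (ContinuousMonoidHom.ext fun _ ↦ rfl) (AddMonoidHom.ext fun _ ↦ rfl) _ _
  have hkerEq : localKer κ.kerSubgroup M v = (ResKernel.resSubgroup N M).ker := by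
    apply le_antisymm
    · intro c hc
      rw [AddMonoidHom.mem_ker, ← hcomp, AddMonoidHom.comp_apply, (AddMonoidHom.mem_ker).mp hc, map_zero]
    · intro c hc
      change c ∈ (resOfLe M hle).ker
      rw [AddMonoidHom.mem_ker, ← hcomp', AddMonoidHom.comp_apply, (AddMonoidHom.mem_ker).mp hc, map_zero]
  -- (ii) the coinvariants: `M^{ker κ_v}/(γ⁻¹ − 1) ≅ B_v/(g − 1)B_v`
  have hfix : ProcyclicDescent.fixedSubgroup (A := M) (ProcyclicDescent.kerK κv) =
      FixedPoints.addSubgroup ↥(κ.kerSubgroup ⊓ decomp v) M := by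
    ext m
    rw [ProcyclicDescent.mem_fixedSubgroup_iff, FixedPoints.mem_addSubgroup]
    constructor
    · intro h x
      have hx := Subgroup.mem_inf.mp x.2
      have hxN : (⟨(x : absoluteGaloisGroup K), Subgroup.mem_inf.mpr ⟨Subgroup.mem_top _, hx.2⟩⟩ : D) ∈
          ProcyclicDescent.kerK κv := by
        rw [hker]; exact Subgroup.mem_subgroupOf.mpr hx.1
      exact h ⟨_, hxN⟩
    · intro h x
      have hxN : (x : D) ∈ N := by rw [← hker]; exact x.2
      exact h ⟨((x : D) : absoluteGaloisGroup K), Subgroup.mem_inf.mpr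
        ⟨Subgroup.mem_subgroupOf.mp hxN, (Subgroup.mem_inf.mp (x : D).2).2⟩⟩
  let e : ProcyclicDescent.fixedSubgroup (A := M) (ProcyclicDescent.kerK κv) ≃+
      FixedPoints.addSubgroup ↥(κ.kerSubgroup ⊓ decomp v) M := AddEquiv.addSubgroupCongr hfix
  have he : AddSubgroup.map
      (e : ProcyclicDescent.fixedSubgroup (A := M) (ProcyclicDescent.kerK κv) →+
        FixedPoints.addSubgroup ↥(κ.kerSubgroup ⊓ decomp v) M)
      (ProcyclicDescent.subOneFixed (ProcyclicDescent.kerK κv) g⁻¹).range =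
      (decompSubOne κ M (g : absoluteGaloisGroup K) hgD).range := by
    ext b
    constructor
    · rintro ⟨x, ⟨y, rfl⟩, rfl⟩
      refine ⟨e y, Subtype.ext ?_⟩
      change (g : absoluteGaloisGroup K) • (y : M) - y = (g⁻¹)⁻¹ • (y : M) - y
      rw [inv_inv]; rfl
    · rintro ⟨y, rfl⟩
      refine ⟨ProcyclicDescent.subOneFixed _ g⁻¹ (e.symm y), ⟨e.symm y, rfl⟩, Subtype.ext ?_⟩
      change (g⁻¹)⁻¹ • (y : M) - y = (g : absoluteGaloisGroup K) • (y : M) - y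
      rw [inv_inv]; rfl
  let eq : ProcyclicDescent.fixedSubgroup (A := M) (ProcyclicDescent.kerK κv) ⧸
      (ProcyclicDescent.subOneFixed (ProcyclicDescent.kerK κv) g⁻¹).range ≃+
      FixedPoints.addSubgroup ↥(κ.kerSubgroup ⊓ decomp v) M ⧸
        (decompSubOne κ M (g : absoluteGaloisGroup K) hgD).range :=
    QuotientAddGroup.congr _ _ e he
  -- assemble
  rw [hkerEq, ← hkerL, hE]
  exact Nat.card_congr eq.toEquiv

end Exact

end Summit.BirchSwinnertonDyer.Rank1Residual.X11b.AcSelmer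

end
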